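import Literature.AlgebraicGeometry.Frobenioids.BirationalizationBiratData
import Literature.AlgebraicGeometry.Frobenioids.ElementaryFrobeniusCompact
import Literature.AlgebraicGeometry.Frobenioids.PerfectionFrobeniusCompact
import HarnessLib

/-!
# Frobenioids I, Def. 1.2 (iv) / Def. 4.5 (iii)(b): Frobenius-compact objects of a birationalization `C^birat`
# from ONE unit with non-zero divisor — PROOF

Mochizuki, *The geometry of Frobenioids I: the general theory*, Kyushu J. Math. **62** (2008) 293–400,
Def. 1.2 (iv) p. 23, Def. 4.5 (iii)(b) p. 86 ("`(C^un-tr)^birat` admits a Frobenius-compact object"), and the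
use made of it in the proofs of Thm. 6.2 (iii) p. 112 l. 8–15 / Thm. 6.4 (i) p. 115 l. 22–23 ("every object of
`(C^un-tr)^birat` is Frobenius-compact"). [cite: MochizukiFrdI2008, Def. 4.5 (iii) p.86]

PROOF-ONLY (seat abc-iut-L1-t3 gen 4; layer 2a of the T64i/L10(b) · T62iii/L10 assembly). For a Frobenioid
`F : C → F_Φ` with square completion `hsq` and an object `A`, write `Θ : C^birat → F_{Φ^gp}` for abc-iut-L6-t8's
`Birat.toElemGp` and `δ = biratDivHom : O^×(A^birat) → Φ^gp(Base A)` (abc-iut-L6-t6, Prop. 4.4 (iii)).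
* `isFrobeniusCompact_of_divisorEnd` — the divisor criterion of `FrobeniusCompactDivisorCriterion.lean` with the
  conjugation action given by mere ENDOMORPHISMS `T_f` of the divisor group of finite order (no group structure on
  `f ↦ T_f` needed);
* `Birat.div_toElemGp_conj` — **the conjugation formula in `C^birat`**: `δ(f u f⁻¹) = Base(Θ f⁻¹)^* δ(u)` (through
  abc-iut-L6-t20's `ElemFrobenioid.div_conj` in `F_{Φ^gp}`);
* `Birat.isFrobeniusCompact_of_unit` — **`A^birat` is Frobenius-compact** as soon as (a) `Φ^gp(Base A)` has no
  torsion, (b) every automorphism of `Base A` acts on `Φ^gp(Base A)` with finite order, (c) `δ` is injective on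
  `O^×(A^birat)`, (d) some unit of `A^birat` has non-trivial divisor.
No definitions; nothing here bears on [IUTchIII] or asserts anything about abc.
-/

namespace Literature.AlgebraicGeometry.Frobenioids

open CategoryTheory Opposite

universe w v v' u u' um

/-! ### The divisor criterion, endomorphism form -/

namespace PreFrobenioidData

variable {C : Type u} [Category.{v} C] {D : Type u'} [Category.{v'} D] (S : PreFrobenioidData.{w} C D)

/-- **Divisor criterion for Frobenius-compactness, endomorphism form** (Def. 1.2 (iv)): as
`isFrobeniusCompact_of_divisorHom` (abc-iut-L1-t3, `FrobeniusCompactDivisorCriterion.lean`), but the conjugation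
by `f ∈ Aut(A)` is only asked to act on divisors through SOME monoid endomorphism `T_f` of the divisor group some
iterate `T_f^[n]`, `n ≥ 1`, of which is the identity. Proof: along the `f`-conjugation orbit `u_k = f^k u₀ f^{-k}` the hypothesis
"`f` acts by `p/q` on `O^×(A)^pf`" reads `δ(u_{k+1})^{q N_k} = δ(u_k)^{p N_k}` with `δ(u_k) = T_f^k(δ u₀)`; through
one period this gives `y^{q^n P} = y^{p^n P}` for `y = δ u₀ ≠ 1`, so `p = q` (no torsion), so `f` acts trivially on
`O^×(A)^pf`; commutativity of `O^×(A)` and the non-torsion unit come from `δ` injective / `δ u₀ ≠ 1`.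
[cite: MochizukiFrdI2008, Def. 1.2 (iv) p.23] -/
theorem isFrobeniusCompact_of_divisorEnd {A : C} {M : Type um} [CommGroup M]
    (δ : S.unitsSubgroup A →* M) (hδ : Function.Injective δ)
    (T : Aut A → (M →* M))
    (hact : ∀ (f : Aut A) (u : Aut A) (hu : u ∈ S.unitsSubgroup A),
      δ ⟨f * u * f⁻¹, S.conj_mem_unitsSubgroup f u hu⟩ = T f (δ ⟨u, hu⟩))
    (hfin : ∀ f : Aut A, ∃ n : ℕ, 0 < n ∧ ∀ x, (T f)^[n] x = x)
    (htf : ∀ (x : M) (n : ℕ), 0 < n → x ^ n = 1 → x = 1)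
    (u₀ : Aut A) (hu₀ : u₀ ∈ S.unitsSubgroup A) (hy : δ ⟨u₀, hu₀⟩ ≠ 1) :
    S.IsFrobeniusCompact A := by
  refine ⟨?_, ?_, ?_⟩
  · intro u hu u' hu'
    have h : δ (⟨u, hu⟩ * ⟨u', hu'⟩) = δ (⟨u', hu'⟩ * ⟨u, hu⟩) := by rw [map_mul, map_mul, mul_comm]
    exact congrArg Subtype.val (hδ h)
  · refine ⟨u₀, hu₀, fun N hN hN1 => hy (htf _ N hN ?_)⟩
    rw [← map_pow]
    have : (⟨u₀, hu₀⟩ : S.unitsSubgroup A) ^ N = 1 := Subtype.ext hN1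
    rw [this, map_one]
  · intro f p q H u hu
    let g : ℕ → Aut A := fun k => f ^ k * u₀ * (f ^ k)⁻¹
    have hg : ∀ k, g k ∈ S.unitsSubgroup A := fun k => S.conj_mem_unitsSubgroup (f ^ k) u₀ hu₀
    have hg0 : g 0 = u₀ := by simp [g]
    have hgsucc : ∀ k, g (k + 1) = f * g k * f⁻¹ := by
      intro k; simp only [g, pow_succ', mul_inv_rev, mul_assoc]
    have hy_succ : ∀ k, δ ⟨g (k + 1), hg (k + 1)⟩ = T f (δ ⟨g k, hg k⟩) := by
      intro k
      rw [← hact f (g k) (hg k)]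
      congr 1
      exact Subtype.ext (hgsucc k)
    have hy_k : ∀ k, δ ⟨g k, hg k⟩ = (T f)^[k] (δ ⟨u₀, hu₀⟩) := by
      intro k
      induction k with
      | zero =>
        rw [show (⟨g 0, hg 0⟩ : S.unitsSubgroup A) = ⟨u₀, hu₀⟩ from Subtype.ext hg0, Function.iterate_zero, id]
      | succ k ih => rw [hy_succ, ih, Function.iterate_succ_apply']
    choose N hN using fun k => H (g k) (hg k)
    obtain ⟨n, hn, hTn⟩ := hfin f
    let P : ℕ := (Finset.range n).prod N
    have hP : 0 < P := Finset.prod_pos fun k _ => (hN k).1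
    have hPdvd : ∀ k < n, N k ∣ P := fun k hk => Finset.dvd_prod_of_mem N (Finset.mem_range.mpr hk)
    have hrel : ∀ k, δ ⟨g (k + 1), hg (k + 1)⟩ ^ ((q : ℕ) * N k) = δ ⟨g k, hg k⟩ ^ ((p : ℕ) * N k) := by
      intro k
      have h := (hN k).2
      have h' : (⟨f * g k * f⁻¹, S.conj_mem_unitsSubgroup f (g k) (hg k)⟩ : S.unitsSubgroup A) ^
          ((q : ℕ) * N k) = ⟨g k, hg k⟩ ^ ((p : ℕ) * N k) := Subtype.ext (by simpa [pow_mul] using h)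
      have h'' := congrArg δ h'
      rw [map_pow, map_pow] at h''
      have hgk : (⟨f * g k * f⁻¹, S.conj_mem_unitsSubgroup f (g k) (hg k)⟩ : S.unitsSubgroup A) =
          ⟨g (k + 1), hg (k + 1)⟩ := Subtype.ext (hgsucc k).symm
      rw [hgk] at h''
      exact h''
    set y := δ ⟨u₀, hu₀⟩ with hy_def
    have hind : ∀ k ≤ n, δ ⟨g k, hg k⟩ ^ ((q : ℕ) ^ k * P) = y ^ ((p : ℕ) ^ k * P) := by
      intro k hk
      induction k with
      | zero =>
        rw [show (⟨g 0, hg 0⟩ : S.unitsSubgroup A) = ⟨u₀, hu₀⟩ from Subtype.ext hg0]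
        simp only [pow_zero, one_mul, hy_def]
      | succ k ih =>
        have hk' : k < n := Nat.lt_of_succ_le hk
        obtain ⟨m, hm⟩ := hPdvd k hk'
        have e1 : (q : ℕ) ^ (k + 1) * P = ((q : ℕ) * N k) * ((q : ℕ) ^ k * m) := by
          rw [hm]; ring
        rw [e1, pow_mul, hrel k, ← pow_mul,
          show (p : ℕ) * N k * ((q : ℕ) ^ k * m) = (p : ℕ) * ((q : ℕ) ^ k * P) by rw [hm]; ring,
          mul_comm (p : ℕ) ((q : ℕ) ^ k * P), pow_mul, ih hk'.le, ← pow_mul]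
        congr 1
        ring
    have hyn : δ ⟨g n, hg n⟩ = y := by rw [hy_k n, hTn]
    have key : y ^ ((q : ℕ) ^ n * P) = y ^ ((p : ℕ) ^ n * P) := by rw [← hind n le_rfl, hyn]
    have hexp : (q : ℕ) ^ n * P = (p : ℕ) ^ n * P := by
      by_contra hne
      rcases Nat.lt_or_gt_of_ne hne with hlt | hgt
      · have h1 : y ^ ((p : ℕ) ^ n * P - (q : ℕ) ^ n * P) = 1 := by
          rw [pow_sub y hlt.le, ← key, mul_inv_cancel]
        exact hy (htf y _ (Nat.sub_pos_of_lt hlt) h1)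
      · have h1 : y ^ ((q : ℕ) ^ n * P - (p : ℕ) ^ n * P) = 1 := by
          rw [pow_sub y hgt.le, key, mul_inv_cancel]
        exact hy (htf y _ (Nat.sub_pos_of_lt hgt) h1)
    have hpq : (p : ℕ) = q := by
      have h1 : (q : ℕ) ^ n = (p : ℕ) ^ n := Nat.eq_of_mul_eq_mul_right hP hexp
      exact (Nat.pow_left_injective hn.ne' h1).symm
    obtain ⟨N', hN', h⟩ := H u hu
    refine ⟨(q : ℕ) * N', Nat.mul_pos q.pos hN', ?_⟩
    rw [pow_mul, h, hpq, pow_mul]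

end PreFrobenioidData

/-! ### Frobenius-compact objects of `C^birat` -/

namespace PreFrobenioid

variable {D : Type u} [Category.{v} D] {Φ : Dᵒᵖ ⥤ CommMonCat.{w}}
  {C : Type u'} [Category.{v'} C] {F : C ⥤ ElemFrobenioid Φ} {hF : IsFrobenioid F} {hsq : HasBiratSquares F}

namespace Birat

/-- The base map of `C^birat → F_{0_D}` on an arrow is the base map of its image under
`Θ : C^birat → F_{Φ^gp}` (unfolding). [cite: MochizukiFrdI2008, Prop. 4.4 (ii) p.83] -/
theorem biratOps_base_map_eq {X Y : Birat F hF hsq} (φ : X ⟶ Y) :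
    (biratOps hF hsq).base.map φ = ElemFrobenioid.Base ((toElemGp hF hsq).map φ) := by
  obtain ⟨f, rfl⟩ := homMk_surjective φ
  rfl

/-- The Frobenius degree for `C^birat → F_{0_D}` is the one read through `Θ : C^birat → F_{Φ^gp}` (unfolding).
[cite: MochizukiFrdI2008, Prop. 4.4 (ii) p.83] -/
theorem biratOps_degFr_eq {X Y : Birat F hF hsq} (φ : X ⟶ Y) :
    (biratOps hF hsq).degFr φ = ElemFrobenioid.degFr ((toElemGp hF hsq).map φ) := by
  obtain ⟨f, rfl⟩ := homMk_surjective φ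
  rfl

/-- A unit of `A^birat` (for `C^birat → F_{0_D}`) maps under `Θ` to a unit of `F_{Φ^gp}`.
[cite: MochizukiFrdI2008, Prop. 4.4 (iii) p.84] -/
theorem mapIso_mem_unitsSubgroup {A : C} (u : Aut ((toBirat F hF hsq).obj A))
    (hu : u ∈ (biratOps hF hsq).unitsSubgroup ((toBirat F hF hsq).obj A)) :
    (toElemGp hF hsq).mapIso u ∈
      PreFrobenioid.unitsSubgroup (ElemFrobenioid.toChar (monoidGp Φ)) ((toElemGp hF hsq).obj ((toBirat F hF hsq).obj A)) := by
  refine ⟨?_, ?_⟩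
  · change ElemFrobenioid.Base ((toElemGp hF hsq).map u.hom) = 𝟙 _
    rw [← biratOps_base_map_eq]; exact hu.1
  · change ElemFrobenioid.degFr ((toElemGp hF hsq).map u.hom) = 1
    rw [← biratOps_degFr_eq]; exact hu.2

/-- **The conjugation formula in `C^birat`**: for `f ∈ Aut(A^birat)` and a unit `u ∈ O^×(A^birat)`,
`δ(f u f⁻¹) = Base(Θ f⁻¹)^* δ(u)` in `Φ^gp(Base A)` — `Aut(A^birat)` acts on the divisors of units through the
automorphisms of `Base A` (abc-iut-L6-t20's `ElemFrobenioid.div_conj` in `F_{Φ^gp}`, read through `Θ`).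
[cite: MochizukiFrdI2008, Def. 1.2 (iv) p.23] -/
theorem div_toElemGp_conj {A : C} (f u : Aut ((toBirat F hF hsq).obj A))
    (hu : u ∈ (biratOps hF hsq).unitsSubgroup ((toBirat F hF hsq).obj A)) :
    biratDivHom hF hsq A ⟨f * u * f⁻¹, (biratOps hF hsq).conj_mem_unitsSubgroup f u hu⟩ =
      pull (monoidGp Φ) (ElemFrobenioid.Base ((toElemGp hF hsq).map f.inv) :) (biratDivHom hF hsq A ⟨u, hu⟩) := by
  let f' : Aut ((toElemGp hF hsq).obj ((toBirat F hF hsq).obj A)) := (toElemGp hF hsq).mapIso f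
  let u' : Aut ((toElemGp hF hsq).obj ((toBirat F hF hsq).obj A)) := (toElemGp hF hsq).mapIso u
  have key := ElemFrobenioid.div_conj f' u' (mapIso_mem_unitsSubgroup u hu)
  have hmap : (f' * u' * f'⁻¹).hom = (toElemGp hF hsq).map (f * u * f⁻¹).hom := by
    change (toElemGp hF hsq).map f.inv ≫ (toElemGp hF hsq).map u.hom ≫ (toElemGp hF hsq).map f.hom =
      (toElemGp hF hsq).map (f.inv ≫ u.hom ≫ f.hom)
    rw [(toElemGp hF hsq).map_comp, (toElemGp hF hsq).map_comp]
  rw [hmap] at key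
  exact key

/-- **`A^birat` is Frobenius-compact from one unit with non-zero divisor** (Def. 1.2 (iv), for `C^birat → F_{0_D}`):
if (a) `Φ^gp(Base A)` has no torsion, (b) every automorphism of `Base A` acts on `Φ^gp(Base A)` with finite order,
(c) the divisor homomorphism `δ : O^×(A^birat) → Φ^gp(Base A)` is injective and (d) some unit `u₀` has `δ u₀ ≠ 1`,
then `A^birat` is Frobenius-compact. [cite: MochizukiFrdI2008, Def. 4.5 (iii) p.86] -/
theorem isFrobeniusCompact_of_unit (A : C)
    (htf : ∀ (x : Algebra.GrothendieckGroup (Φ.obj (op (baseObj F A)))) (n : ℕ), 0 < n → x ^ n = 1 → x = 1)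
    (hfin : ∀ g : baseObj F A ⟶ baseObj F A, IsIso g →
      ∃ n : ℕ, 0 < n ∧ ∀ x, (pull (monoidGp Φ) g)^[n] x = x)
    (hδ : Function.Injective (biratDivHom hF hsq A))
    (u₀ : Aut ((toBirat F hF hsq).obj A)) (hu₀ : u₀ ∈ (biratOps hF hsq).unitsSubgroup ((toBirat F hF hsq).obj A))
    (hy : biratDivHom hF hsq A ⟨u₀, hu₀⟩ ≠ 1) :
    (biratOps hF hsq).IsFrobeniusCompact ((toBirat F hF hsq).obj A) := by
  refine (biratOps hF hsq).isFrobeniusCompact_of_divisorEnd (biratDivHom hF hsq A) hδ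
    (fun f => pull (monoidGp Φ) (ElemFrobenioid.Base ((toElemGp hF hsq).map f.inv) :))
    (fun f u hu => div_toElemGp_conj f u hu) (fun f => ?_) htf u₀ hu₀ hy
  have h1 : (ElemFrobenioid.Base ((toElemGp hF hsq).map f.inv) :) ≫
      (ElemFrobenioid.Base ((toElemGp hF hsq).map f.hom) :) = 𝟙 (baseObj F A) := by
    rw [← ElemFrobenioid.base_comp, ← (toElemGp hF hsq).map_comp, f.inv_hom_id, (toElemGp hF hsq).map_id]
    rfl
  have h2 : (ElemFrobenioid.Base ((toElemGp hF hsq).map f.hom) :) ≫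
      (ElemFrobenioid.Base ((toElemGp hF hsq).map f.inv) :) = 𝟙 (baseObj F A) := by
    rw [← ElemFrobenioid.base_comp, ← (toElemGp hF hsq).map_comp, f.hom_inv_id, (toElemGp hF hsq).map_id]
    rfl
  have hiso : IsIso (ElemFrobenioid.Base ((toElemGp hF hsq).map f.inv) :) := ⟨⟨_, h1, h2⟩⟩
  exact hfin _ hiso

end Birat

end PreFrobenioid

end Literature.AlgebraicGeometry.Frobenioids
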